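import Summits.BirchSwinnertonDyer.BirchSwinnertonDyer.Theorems.PrintX10bMuPartOfPrintKSAnyClassNumber
import Summits.BirchSwinnertonDyer.BirchSwinnertonDyer.Theorems.PrintX10bBeyondCarrierOfMuPartStabilizedCoherentPair
import Summits.BirchSwinnertonDyer.BirchSwinnertonDyer.Theorems.PrintX10bTwoSidedLinkAnyClassNumberX10bOfPrintFactsPinnedLevel
import Literature.NumberTheory.EllipticCurves.AnticyclotomicTowerSharpProofs
import HarnessLib

/-!
# Crux `BeyondCarrierDepthX10b` (stmt-BirchSwinnertonDyer-23055, PrintX10b aside r301), line «twins» — the crux BY NAME from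
# TEN cite-only print facts, modulo the control-glue letter of the KS μ-chain without its idle binders (part IV of «hhK-IDLE»)

HONEST FRAMING (cell `run/shared/lean/pub/bsd-print-x9/`, seat bsd-line-x10b-p1 LEAD g11, registered line «twins», skeleton v8
`Cruxes/BeyondCarrierDepthX10b/Lines/twins.lean` sha d9aa95dab226; D-0154 KEY row 10): THEOREMS ONLY, conditional glue
`--supports 23055` (helper); nothing booked, nothing closed. «beyond-print theorem»: NO. BSD is not proved by any of this; no summit
statement is proved by this seat.

WHY. The census of crux 23055 splits the frames by `3 ∣ h_K`: the divisible frames run through the CGLS «any class number» road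
(CGLS Thm. 4.1.3 `hCGLS` + the coherent-pair μ-letter from Howard Thm. 1.6.1 `h161` and CGLS Thm. 4.1.1 `h411`), the coprime frames
through Mastella–Zerman 2026 Cor. 4.6 (`h46`, Howard's divisibility under `p`-adic scalar image). FINDING «hhK-IDLE» (parts I–III:
`PrintX9MuPartKSLettersAnyClassNumber`, x10b-p1-w8 g9's `PrintX10bControlGlueKSAnyClassNumber`, `PrintX10bMuPartOfPrintKSAnyClassNumber`):
no proof of the KS μ-chain uses `p ∣ h_K` (nor `¬CM`, nor the scalar image) — the binder was inherited from the μ-crux frames. So the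
CGLS road serves EVERY frame, and the census of record needs neither the case split nor MZ26:
**crux 23055 BY NAME ⟸ TEN cite-only print facts** — CGLS Thm. 4.1.3 localized (`hCGLS`) · Castella/Yan–Zhu Thm. 5.7 (1) (`h57`) · the
pinned (T2)-general Heegner⟷BDP transfer at `s = 1` (`h59gp`, inline) · BCS Prop. 4.2.2 (`h422`) · CGLS Thm. 5.1.3 (`h513`) · JSW
Thm. 3.3.1 (`h331`) · Cha Rmk. 25 (`hChaL`) · Kolyvagin Thm. A (`hKo`) · Howard Thm. 1.6.1 (`h161`) · CGLS Thm. 4.1.1 KS form (`h411`)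
— modulo, in THIS file, the hypothesis `hB` = the control-glue letter `HeegnerMuPartControlGlue.Stmt.controlGlueKS` with its three
idle binders deleted (spelled out; part II proves it from the landed (B4)/(B5) readout stubs, whose proofs introduce those binders as
`_`); the `hB`-free ten-leaf census is the one-line specialisation filed after part II.

WHAT.
* §1 `HowardFrames.upperLinkX10b_anyClassNumber_of_howard_kolyvaginSystem_of_printFacts_of_controlGlue (hCGLS h57 h59gp h422 h513
  h331 h161 h411) (hB)` — U₃ on EVERY X10b frame (no class-number hypothesis): `PrintX10bBeyondCarrierOfElevenPrintLeaves` §1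
  verbatim with the coherent pair from part III's
  `exists_coherentPair_isTorsion_muIneq_of_howard_kolyvaginSystem_anyClassNumber_of_controlGlue h161 h411 hB`.
* §2 **`HowardFrames.beyondCarrierDepthX10b_of_tenPrintLeaves_of_controlGlue (hCGLS h57 h59gp h422 h513 h331 hChaL hKo h161 h411)
  (hB) : BeyondCarrierDepthX10b`** := p609388 `stub_beyondCarrier_of_upperLink_of_namedFacts h331 hChaL hKo` ∘ §1 — NO case split.

References: [CastellaGrossiLeeSkinner2022] Thm. 4.1.1, Rem. 4.1.4, Thm. 4.1.3, Cor. 3.4.2, Thm. 5.1.3, §3.2/§4.1 (no class-number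
hypothesis); [Howard2004HeegnerKolyvagin] Thm. 1.6.1, Thm. 2.2.10 (proof), §3.3; [YanZhu2024MainConjNonCM] Thm. 5.7 (1), 5.9;
[BurungaleCastellaSkinner2025] Prop. 4.2.2; [JetchevSkinnerWan2017] Thm. 3.3.1; [Cha2005] Rmk. 25; [Kolyvagin1990] Thm. A;
[Castella2018] §5; [LombardoTronto2022] Prop. 3.12; [PerrinRiou1987BSMF] §3; [Cox2013] Thm. 7.24 / 11.1.
-/

-- the REGISTERED stub namespace `Summit.BirchSwinnertonDyer.BirchSwinnertonDyer.Cruxes.…` repeats the summit name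
set_option linter.dupNamespace false
set_option autoImplicit false

noncomputable section

open scoped Classical Pointwise ContRepresentation TensorProduct NumberField

open WeierstrassCurve NumberField IsDedekindDomain Field Literature Literature.NumberTheory.EllipticCurves
  Literature.NumberTheory.EllipticCurves.ModularForms Literature.NumberTheory.EllipticCurves.Rank1Residual
  Literature.NumberTheory.EllipticCurves.Castella2018 Literature.NumberTheory.EllipticCurves.YanZhu2026
  Literature.NumberTheory.EllipticCurves.CastellaGrossiLeeSkinner2022
  Literature.NumberTheory.EllipticCurves.JetchevSkinnerWan2017
open Literature.NumberTheory.GaloisCohomology Literature.NumberTheory.GaloisCohomology.Howard2004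
open Literature.NumberTheory.GaloisRepresentations Literature.NumberTheory.GaloisRepresentations.DiscreteGaloisModule

open Summit.BirchSwinnertonDyer.Rank1Residual
open Summit.BirchSwinnertonDyer.BirchSwinnertonDyer.Rank1Residual (X10.thm413Hypotheses_of_classX10)
open Summit.BirchSwinnertonDyer.BirchSwinnertonDyer.Cruxes.TwoSidedLinkAnyClassNumberX10b.CompositeTransferX10b
  (imcWaldspurgerOnTreeGoodAt_inducedPlace_of_printFacts_of_pinnedTransfer_of_level)
open Summit.BirchSwinnertonDyer.BirchSwinnertonDyer.Theorems
open Summit.BirchSwinnertonDyer.BirchSwinnertonDyer.Theorems.HeegnerMuPartControlGlue (Stmt.kummerStrictOnFrames)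
open Summit.BirchSwinnertonDyer.BirchSwinnertonDyer.Theorems.HeegnerMuPartKSAnyClassNumber
  (exists_coherentPair_isTorsion_muIneq_of_howard_kolyvaginSystem_anyClassNumber_of_controlGlue)
open Summit.BirchSwinnertonDyer.BirchSwinnertonDyer.Theses.PrintX10b (BeyondCarrierDepthX10b)

namespace Summit.BirchSwinnertonDyer.BirchSwinnertonDyer.Cruxes.BeyondCarrierDepthX10b.HowardFrames

open Summit.BirchSwinnertonDyer.BirchSwinnertonDyer.Cruxes.BeyondCarrierDepthX10b.UpperHalf (upperLink_of_imcWaldspurgerOnTreeGoodAt)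

/-! ## §1 U₃ on every X10b frame (any class number), modulo the control-glue letter -/

/-- **U₃ on EVERY X10b frame — no class-number hypothesis — from Howard Thm. 1.6.1 (`h161`) and CGLS Thm. 4.1.1 in Kolyvagin-system form
(`h411`), modulo six further print facts** (`hCGLS` CGLS Thm. 4.1.3 localized; `h57 h59gp h422 h513 h331` the pinned class-number-free
transfer inputs) **and the control-glue letter without idle binders (`hB`)**: `PrintX10bBeyondCarrierOfElevenPrintLeaves` §1 verbatim,
the coherent pair, the torsion of `𝔖/Λκ_∞(C)` and the μ-inequality now from part III's
`exists_coherentPair_isTorsion_muIneq_of_howard_kolyvaginSystem_anyClassNumber_of_controlGlue h161 h411 hB` (no `p ∣ h_K`, no `¬CM`, no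
scalar image); rank one := CGLS Thm. 4.1.3 (i); tower := `anticyclotomicTowerSharp`; pinned transfer at the pinned level (p686788).
[cite: Howard2004HeegnerKolyvagin, Thm. 1.6.1, Thm. 2.2.10 (proof) and §3.3]
[cite: CastellaGrossiLeeSkinner2022, Thm. 4.1.1, Rem. 4.1.4, Thm. 4.1.3 and Cor. 3.4.2] [cite: Washington1997, §13.2]
[cite: YanZhu2024MainConjNonCM, Thm. 5.7 (1) and Thm. 5.9] [cite: BurungaleCastellaSkinner2025, Prop. 4.2.2]
[cite: JetchevSkinnerWan2017, Thm. 3.3.1] [cite: Castella2018, §5 (eq:IMC+BDP)] [cite: LombardoTronto2022, Prop. 3.12]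
[cite: Cox2013, §7.D Thm. 7.24 and §11.A Thm. 11.1] [cite: PerrinRiou1987BSMF, §3.2] -/
theorem upperLinkX10b_anyClassNumber_of_howard_kolyvaginSystem_of_printFacts_of_controlGlue
    (hCGLS : thm413_rankOne_charIdeal_torsion_dvd_localized.{0})
    (h57 : thm57_isTorsion_charIdealXGr_eq_bdpLFunction)
    (h59gp : ∀ {p : ℕ} [Fact p.Prime] (ι' : PadicAlgCl p ≃+* ℂ) (W : WeierstrassCurve ℚ) [W.IsElliptic]
      [W.IsGloballyMinimal] (K : Type) [Field K] [NumberField K] (v vbar : HeightOneSpectrum (𝓞 K))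
      (κ : ZpExtension K p) (γ : absoluteGaloisGroup K) [Fact (κ.IsTopGenerator γ)] {N : ℕ} [NeZero N]
      {f : CuspForm (CongruenceSubgroup.Gamma0 N) 2} (jbar : AlgebraicClosure K →+* ℂ)
      (_ : IsNewformOf W f),
      N = W.conductorNorm ℤ → 3 ≤ p → GoodOrd W p → (W.baseChange K).HasIrreducibleModPGaloisRep p →
      IsImaginaryQuadratic K → SatisfiesHeegnerHypothesis N K →
        ((Ideal.span {(p : ℤ)}).primesOver (𝓞 K)).ncard = 2 →
        Odd (NumberField.discr K) → NumberField.discr K ≠ -3 → κ.IsAnticyclotomic →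
      (∀ (w : InfinitePlace K) (k : 𝓞 K), k ∈ v.asIdeal ↔ ‖ι'.symm (w.embedding (k : K))‖ < 1) →
        ((p : ℕ) : 𝓞 K) ∈ vbar.asIdeal → vbar ≠ v →
      ∃ (ΩK : ℂ) (Ωp : (unrIntegers p)ˣ) (L : UnrSeries p),
        ΩK ≠ 0 ∧ IsBDPLFunction ι' v κ γ f ΩK ((Ωp : unrIntegers p) : ℂ_[p]) L ∧
        ∀ (D : (W.baseChange K).LambdaAdicSelmerData κ γ) (F : HeegnerFamily N W K κ jbar)
          (X : (W.baseChange K).SelmerDualData κ γ) (j : ℤ_[p] →+* unrIntegers p),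
          ¬ (p : ℤ) ∣ F.Dt.c →
          (∀ x : ℤ_[p], ((j x : unrIntegers p) : ℂ_[p]) = algebraMap ℚ_[p] ℂ_[p] (x : ℚ_[p])) →
          heegnerCharIdeal D F ^ 2 ≤
              Module.charIdeal (IwasawaAlgebra p) (Submodule.torsion (IwasawaAlgebra p) X.X) →
            L ∈ (AcSelmer.XAc.charIdeal (W.baseChange K) p κ vbar ∅ γ).map (PowerSeries.map j))
    (h422 : BurungaleCastellaSkinner2025.prop422_exists_isBDPLFunction_mu_eq_zero)
    (h513 : thm513_exists_isBDPLFunction_valueAtOne_disc)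
    (h331 : thm331_anticyclotomicControl)
    (h161 : Literature.NumberTheory.GaloisCohomology.Howard2004.thm161_dvrKolyvaginBound)
    (h411 : CastellaGrossiLeeSkinner2022.thm411_exists_kolyvaginSystem_one_ne_zero)
    (hB : Stmt.kummerStrictOnFrames →
    ∀ (N : ℕ) [NeZero N] (W : WeierstrassCurve ℚ) [W.IsGloballyMinimal] (K : Type) [Field K] [NumberField K]
      (p : ℕ) [Fact p.Prime] (κ : ZpExtension K p) (γ : Field.absoluteGaloisGroup K)
      (jbar : AlgebraicClosure K →+* ℂ) (hyp : CastellaGrossiLeeSkinner2022.Thm413Hypotheses N W K p κ γ),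
      W.HasIrreducibleModPGaloisRep p → (W.baseChange K).HasIrreducibleModPGaloisRep p →
      SatisfiesHeegnerHypothesis p K →
      ∀ (D : (W.baseChange K).LambdaAdicSelmerData κ γ)
        (C : CastellaGrossiLeeSkinner2022.StabilizedHeegnerData N W K κ jbar)
        (X : (W.baseChange K).SelmerDualData κ γ) (z : D.S),
      (∀ (k : ℕ) (hk : C.depth < k), D.proj k z ∈ CastellaGrossiLeeSkinner2022.stabilizedClassLayer C k hk) →
      CastellaGrossiLeeSkinner2022.stabilizedHeegnerModule D C = Submodule.span (IwasawaAlgebra p) {z} →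
      Module.Finite (IwasawaAlgebra p) D.S → Module.Finite (IwasawaAlgebra p) X.X →
      Module.IsTorsion (IwasawaAlgebra p) (D.S ⧸ CastellaGrossiLeeSkinner2022.stabilizedHeegnerModule D C) →
      z ≠ 0 →
      ∃ c m₁ : ℕ, ∀ (m : ℕ) (hm : 1 ≤ m), m₁ ≤ m →
        haveI := hyp.isElliptic
        letI := IwasawaAlgebra.isDomain_quotient_X_pow_add_C p hm
        letI := IwasawaAlgebra.isDiscreteValuationRing_quotient_X_pow_add_C p hm
        haveI := IwasawaAlgebra.EisensteinCoeff.isLocalRing_succ p hm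
        letI := IwasawaAlgebra.EisensteinCoeff.algebraOfSpecSucc p m
        haveI := W.isScalarTower_algebraOfSpecSucc (K := K) (p := p) (m := m)
        letI := W.residueModuleSucc (K := K) (p := p) hm
        ∀ (S : Finset (IsDedekindDomain.HeightOneSpectrum (NumberField.RingOfIntegers K)))
          (hpS : ∀ v, ((p : ℕ) : NumberField.RingOfIntegers K) ∈ v.asIdeal → v ∈ S)
          (hbad : ∀ v, v ∉ S → ((p : ℕ) : NumberField.RingOfIntegers K) ∉ v.asIdeal →
            (W.baseChange K).HasGoodReductionAt v)
          (_hSN : ∀ v ∈ S, ((p : ℕ) : NumberField.RingOfIntegers K) ∈ v.asIdeal ∨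
            ((N : ℕ) : NumberField.RingOfIntegers K) ∈ v.asIdeal)
          (_hSσ : ∀ (σ : K ≃ₐ[ℚ] K) (v : IsDedekindDomain.HeightOneSpectrum (NumberField.RingOfIntegers K)),
            σ • v ∈ S → v ∈ S)
          (L : Set (IsDedekindDomain.HeightOneSpectrum (NumberField.RingOfIntegers K)))
          (hL : L ⊆ (W.eisensteinTower (κ.unitTwist (-1)) hm).degreeTwoPrimes p)
          (hLS : ∀ v ∈ L, v ∉ S) (jbar' : AlgebraicClosure K →+* ℂ) (cd : ConjugationDatum K)
          (Dd : ∀ k, DualityDatum p cd ((W.eisensteinTower (κ.unitTwist (-1)) hm).ρ k)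
            (IwasawaAlgebra.EisensteinCoeff p m (k + 1)))
          (fs : ∀ (k : ℕ) (n : Finset (IsDedekindDomain.HeightOneSpectrum (NumberField.RingOfIntegers K)))
            (v : IsDedekindDomain.HeightOneSpectrum (NumberField.RingOfIntegers K)),
            galoisCohomology ((W.eisensteinLevelQuot (κ.unitTwist (-1)) hm k n).toLocal (Sum.inr v)) 1 →+
              SingularQuotient (GaloisRep.toLocal v (W.eisensteinLevelQuot (κ.unitTwist (-1)) hm k n)) ⊗[ℤ]
                Gell v)
          (t : ∀ k, ((W.baseChange K).torsionGaloisModule ((p : ℤ) ^ (k + 1))).toContRepresentation →ⁱL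
            ((W.baseChange K).torsionGaloisModule ((p : ℤ) ^ k)).toContRepresentation)
          (ht : ∀ k (P : geomTorsion (W.baseChange K) ((p : ℤ) ^ (k + 1))),
            t k P = (W.baseChange K).geomTorsionReduce p k P)
          (I : ZpExtension.EisensteinH1Data (κ.unitTwist (-1))
            (fun k ↦ (W.baseChange K).torsionGaloisModule ((p : ℤ) ^ k)) t hm)
          (hy : (W.eisensteinDVRSetting (κ.unitTwist (-1)) hm S hpS hbad L hL hLS jbar' cd Dd fs).SatisfiesH),
          (W.eisensteinDVRSetting (κ.unitTwist (-1)) hm S hpS hbad L hL hLS jbar' cd Dd fs).Conclusion hy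
              (fun k ↦ I.proj (k + 1) (D.toEisensteinH1Linear hm t ht I hyp.topGenerator hyp.noPTorsion z)) →
            Nonempty (HeegnerMuPartStabilized.SpecWitness (IwasawaAlgebra p) D.S X.X
              (CastellaGrossiLeeSkinner2022.stabilizedHeegnerModule D C)
              (PowerSeries.X ^ m + PowerSeries.C (p : ℤ_[p]) : IwasawaAlgebra p) (p ^ c))) :
    ∀ (W : WeierstrassCurve ℚ) [W.IsElliptic] [W.IsGloballyMinimal] (p : ℕ) [Fact p.Prime]
    [NeZero (W.conductorNorm ℤ)] (K : Type) [Field K] [NumberField K],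
    Literature.NumberTheory.EllipticCurves.Rank1Residual.ClassX10 W p →
    ¬ Literature.NumberTheory.EllipticCurves.Rank1Residual.Surj W 3 → ¬ W.HasCM →
    Literature.NumberTheory.EllipticCurves.IsImaginaryQuadratic K → Odd (NumberField.discr K) →
    NumberField.discr K ≠ -3 →
    Literature.NumberTheory.EllipticCurves.SatisfiesHeegnerHypothesis (W.conductorNorm ℤ) K →
    Literature.NumberTheory.EllipticCurves.SatisfiesHeegnerHypothesis p K →
    (W.baseChange K).HasIrreducibleModPGaloisRep p →
    ∀ (ι : K →+* ℚ_[p]) (κ : Literature.NumberTheory.EllipticCurves.ZpExtension K p), κ.IsAnticyclotomic →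
    ∀ (γ : Field.absoluteGaloisGroup K) [Fact (κ.IsTopGenerator γ)]
    (Dt : Literature.NumberTheory.EllipticCurves.ModularForms.ModularParametrizationData W
    (W.conductorNorm ℤ)), ¬ (p : ℤ) ∣ Dt.c →
    ∀ (H : Literature.NumberTheory.EllipticCurves.HeegnerDatum (W.conductorNorm ℤ) (NumberField.discr K))
    (ιC : K →+* ℂ) (P : (W.baseChange K).toAffine.Point),
    WeierstrassCurve.Affine.Point.map ιC.toRatAlgHom P =
    Literature.NumberTheory.EllipticCurves.ModularForms.heegnerPointComplex Dt H →
    (W.baseChange K).mordellWeilRank = 1 →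
    Finite (AddCommGroup.primaryComponent (W.baseChange K).sha p) → ¬ IsOfFinAddOrder P →
    ∃ n : ℕ, Summit.BirchSwinnertonDyer.Rank1Residual.X11b.AcSelmer.XAc.HasCharValuationAt
    (W.baseChange K) p κ (Summit.BirchSwinnertonDyer.Rank1Residual.X11b.inducedPlace ι) ∅ γ n ∧
    (n : ℤ) ≤ 2 * (Summit.BirchSwinnertonDyer.Rank1Residual.X11b.padicLogOrd W p ι P +
    (padicValInt p (1 - W.frobeniusTrace p + p) : ℤ) - 1) := by
  intro W _ _ p _ _ K _ _ hX _hns _hcm hK hodd h3 hHN hHp hirr ι κ hκ γ _ Dt hc H ιC P hP hrk hfin hPinf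
  have hγ : κ.IsTopGenerator γ := Fact.out
  have hp : p.Prime := Fact.out
  have hp_odd : Odd p := hp.odd_of_ne_two hX.ne_two
  -- an embedding `K̄ → ℂ` over `ιC` for the tied family
  letI : Algebra K ℂ := ιC.toAlgebra
  let jbar : AlgebraicClosure K →+* ℂ :=
    (IsAlgClosed.lift (R := K) (M := ℂ) (S := AlgebraicClosure K)).toRingHom
  -- the data exist (tree theorems)
  obtain ⟨D⟩ := WeierstrassCurve.LambdaAdicSelmerDataExists.nonempty_lambdaAdicSelmerData (W.baseChange K) p κ hγ
  obtain ⟨X⟩ := (W.baseChange K).nonempty_selmerDualData_holds κ γ hγ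
  have hyp := X10.thm413Hypotheses_of_classX10 hX hK h3 hHN hHp hodd hκ hγ
  -- the coherent pair `(C, F)` on `(Dt, H.β)`, the TORSION of `𝔖/Λκ_∞(C)` and the μ-inequality at that `C`, all conditional only on
  -- Λ-rank one — from Howard Thm. 1.6.1 + CGLS Thm. 4.1.1 (KS form) (p689159 §2); tower clause := `anticyclotomicTowerSharp`
  obtain ⟨C, F, -, hFDt, -, -, hfwd, ⟨g, hg, hrev⟩, htor, hineq⟩ :=
    exists_coherentPair_isTorsion_muIneq_of_howard_kolyvaginSystem_anyClassNumber_of_controlGlue h161 h411 hB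
      (W.conductorNorm ℤ) W K p κ γ jbar hyp hX.irr hirr hHp (ClassX10.not_dvd_conductorNorm hX)
      (fun k ↦ anticyclotomicTowerSharp K p hp_odd hK κ hκ jbar k)
      (card_ringClassGalOver_prime_one_of_frame hK hodd h3 hp hHp jbar) Dt H.β H.dvd_sq_sub D X
  -- CGLS Thm. 4.1.3 at `(D, C, X)`: clause (i) gives the rank-one premisses
  obtain ⟨⟨hfinS, hS1⟩, hfinX, -⟩ := hCGLS (W.conductorNorm ℤ) W K p κ γ jbar hyp D C X
  -- `𝔖/Λκ_∞(C)` torsion (DERIVED, no `hNV`), transported to `𝔖/ℋ_∞(F)` along the reverse envelope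
  have htorC : Module.IsTorsion (IwasawaAlgebra p) (D.S ⧸ stabilizedHeegnerModule D C) := (htor hfinS hS1).2
  have htorF : Module.IsTorsion (IwasawaAlgebra p) (D.S ⧸ heegnerModule D F) :=
    isTorsion_quotient_heegnerModule_of_smul_stabilizedHeegnerModule_le D F C hg hrev htorC
  obtain ⟨m, hm⟩ := span_pow_mul_sq_le_charIdeal_torsion_of_thm413 hCGLS hyp
    (X9.selmerCorank_eq_one_of_rank_one hrk hfin) D C X
  haveI := hfinX
  haveI := hfinS
  haveI : IsNoetherian (IwasawaAlgebra p) X.X := isNoetherian_of_isNoetherianRing_of_finite _ _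
  haveI : Module.Finite (IwasawaAlgebra p) (Submodule.torsion (IwasawaAlgebra p) X.X) := inferInstance
  haveI : Module.Finite (IwasawaAlgebra p) (D.S ⧸ stabilizedHeegnerModule D C) := inferInstance
  -- the μ-part IN THE STABILISED CURRENCY at the pair's own `C`: promotion
  have hleC : stabilizedHeegnerCharIdeal D C ^ 2 ≤
      Module.charIdeal (IwasawaAlgebra p) (Submodule.torsion (IwasawaAlgebra p) X.X) :=
    IwasawaAlgebra.sq_charIdeal_le_charIdeal_of_span_p_pow_mul_le_of_lengthAt_le_two_mul
      (Submodule.torsion_isTorsion (R := IwasawaAlgebra p) (M := X.X)) htorC (hineq hfinS hfinX hS1) hm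
  -- the forward envelope LAST: `I(ℋ_∞(F)) ⊆ I(Λκ_∞(C))`, so the TIED containment holds for `F`
  have hle : heegnerCharIdeal D F ^ 2 ≤
      Module.charIdeal (IwasawaAlgebra p) (Submodule.torsion (IwasawaAlgebra p) X.X) :=
    (Ideal.pow_right_mono (heegnerCharIdeal_le_stabilizedHeegnerCharIdeal_of_le D F C htorF hfwd) 2).trans hleC
  -- the pinned class-number-free transfer at the pinned level (`rfl`), then the `≤` half
  obtain ⟨hp3, hord, -, -⟩ := id hX
  subst hp3
  exact upperLink_of_imcWaldspurgerOnTreeGoodAt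
    (imcWaldspurgerOnTreeGoodAt_inducedPlace_of_printFacts_of_pinnedTransfer_of_level h57 h59gp h422 h513 h331
      le_rfl hord hK hodd h3 rfl hHN hHp hirr ι κ hκ γ Dt hc H ιC P hP hrk hfin hPinf ⟨jbar, D, F, X, hFDt, hle⟩)

/-! ## §2 The census: ten cite-only print facts, no case split (modulo the control-glue letter) -/

/-- **Crux `BeyondCarrierDepthX10b` (stmt-BirchSwinnertonDyer-23055) BY NAME from TEN cite-only print facts and the control-glue letter
without idle binders** — `hCGLS` CGLS Thm. 4.1.3 · `h57` `h59gp` `h422` `h513` `h331` (pinned transfer, JSW control) · `hChaL` Cha Rmk. 25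
· `hKo` Kolyvagin Thm. A · `h161` Howard Thm. 1.6.1 · `h411` CGLS Thm. 4.1.1 (KS form); NO Mastella–Zerman 2026 Cor. 4.6, NO case split
on `3 ∣ h_K` (relative to the eleven-leaf census: `h46` dropped; relative to p681886: `hNV`, `hC`, `hCG`, `h46` dropped). Glue p609388
`stub_beyondCarrier_of_upperLink_of_namedFacts h331 hChaL hKo` over §1. `hB` is discharged by part II (x10b-p1-w8 g9). What is NOT
proved: any of the ten leaves; the crux unconditionally; BSD. CONDITIONAL; credits nothing.
[cite: CastellaGrossiLeeSkinner2022, Thm. 4.1.1, Thm. 4.1.3 and Thm. 5.1.3] [cite: Howard2004HeegnerKolyvagin, Thm. 1.6.1 and Thm. 2.2.10 (proof)]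
[cite: YanZhu2024MainConjNonCM, Thm. 5.7 (1), 5.9] [cite: BurungaleCastellaSkinner2025, Prop. 4.2.2] [cite: JetchevSkinnerWan2017, Thm. 3.3.1]
[cite: Cha2005, Rmk. 25] [cite: Kolyvagin1990, Thm. A] [cite: Cox2013, §7.D Thm. 7.24 and §11.A Thm. 11.1] [cite: PerrinRiou1987BSMF, §3.2] -/
theorem beyondCarrierDepthX10b_of_tenPrintLeaves_of_controlGlue
    (hCGLS : thm413_rankOne_charIdeal_torsion_dvd_localized.{0})
    (h57 : thm57_isTorsion_charIdealXGr_eq_bdpLFunction)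
    (h59gp : ∀ {p : ℕ} [Fact p.Prime] (ι' : PadicAlgCl p ≃+* ℂ) (W : WeierstrassCurve ℚ) [W.IsElliptic]
      [W.IsGloballyMinimal] (K : Type) [Field K] [NumberField K] (v vbar : HeightOneSpectrum (𝓞 K))
      (κ : ZpExtension K p) (γ : absoluteGaloisGroup K) [Fact (κ.IsTopGenerator γ)] {N : ℕ} [NeZero N]
      {f : CuspForm (CongruenceSubgroup.Gamma0 N) 2} (jbar : AlgebraicClosure K →+* ℂ)
      (_ : IsNewformOf W f),
      N = W.conductorNorm ℤ → 3 ≤ p → GoodOrd W p → (W.baseChange K).HasIrreducibleModPGaloisRep p →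
      IsImaginaryQuadratic K → SatisfiesHeegnerHypothesis N K →
        ((Ideal.span {(p : ℤ)}).primesOver (𝓞 K)).ncard = 2 →
        Odd (NumberField.discr K) → NumberField.discr K ≠ -3 → κ.IsAnticyclotomic →
      (∀ (w : InfinitePlace K) (k : 𝓞 K), k ∈ v.asIdeal ↔ ‖ι'.symm (w.embedding (k : K))‖ < 1) →
        ((p : ℕ) : 𝓞 K) ∈ vbar.asIdeal → vbar ≠ v →
      ∃ (ΩK : ℂ) (Ωp : (unrIntegers p)ˣ) (L : UnrSeries p),
        ΩK ≠ 0 ∧ IsBDPLFunction ι' v κ γ f ΩK ((Ωp : unrIntegers p) : ℂ_[p]) L ∧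
        ∀ (D : (W.baseChange K).LambdaAdicSelmerData κ γ) (F : HeegnerFamily N W K κ jbar)
          (X : (W.baseChange K).SelmerDualData κ γ) (j : ℤ_[p] →+* unrIntegers p),
          ¬ (p : ℤ) ∣ F.Dt.c →
          (∀ x : ℤ_[p], ((j x : unrIntegers p) : ℂ_[p]) = algebraMap ℚ_[p] ℂ_[p] (x : ℚ_[p])) →
          heegnerCharIdeal D F ^ 2 ≤
              Module.charIdeal (IwasawaAlgebra p) (Submodule.torsion (IwasawaAlgebra p) X.X) →
            L ∈ (AcSelmer.XAc.charIdeal (W.baseChange K) p κ vbar ∅ γ).map (PowerSeries.map j))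
    (h422 : BurungaleCastellaSkinner2025.prop422_exists_isBDPLFunction_mu_eq_zero)
    (h513 : thm513_exists_isBDPLFunction_valueAtOne_disc)
    (h331 : thm331_anticyclotomicControl)
    (hChaL : Cha2005.rmk25_pow_dvd_card_sha_primary_of_certificate)
    (hKo : ∀ (N : ℕ) [NeZero N] (W : WeierstrassCurve ℚ) (K : Type) [Field K] [NumberField K],
      kolyvagin N W K)
    (h161 : Literature.NumberTheory.GaloisCohomology.Howard2004.thm161_dvrKolyvaginBound)
    (h411 : CastellaGrossiLeeSkinner2022.thm411_exists_kolyvaginSystem_one_ne_zero)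
    (hB : Stmt.kummerStrictOnFrames →
    ∀ (N : ℕ) [NeZero N] (W : WeierstrassCurve ℚ) [W.IsGloballyMinimal] (K : Type) [Field K] [NumberField K]
      (p : ℕ) [Fact p.Prime] (κ : ZpExtension K p) (γ : Field.absoluteGaloisGroup K)
      (jbar : AlgebraicClosure K →+* ℂ) (hyp : CastellaGrossiLeeSkinner2022.Thm413Hypotheses N W K p κ γ),
      W.HasIrreducibleModPGaloisRep p → (W.baseChange K).HasIrreducibleModPGaloisRep p →
      SatisfiesHeegnerHypothesis p K →
      ∀ (D : (W.baseChange K).LambdaAdicSelmerData κ γ)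
        (C : CastellaGrossiLeeSkinner2022.StabilizedHeegnerData N W K κ jbar)
        (X : (W.baseChange K).SelmerDualData κ γ) (z : D.S),
      (∀ (k : ℕ) (hk : C.depth < k), D.proj k z ∈ CastellaGrossiLeeSkinner2022.stabilizedClassLayer C k hk) →
      CastellaGrossiLeeSkinner2022.stabilizedHeegnerModule D C = Submodule.span (IwasawaAlgebra p) {z} →
      Module.Finite (IwasawaAlgebra p) D.S → Module.Finite (IwasawaAlgebra p) X.X →
      Module.IsTorsion (IwasawaAlgebra p) (D.S ⧸ CastellaGrossiLeeSkinner2022.stabilizedHeegnerModule D C) →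
      z ≠ 0 →
      ∃ c m₁ : ℕ, ∀ (m : ℕ) (hm : 1 ≤ m), m₁ ≤ m →
        haveI := hyp.isElliptic
        letI := IwasawaAlgebra.isDomain_quotient_X_pow_add_C p hm
        letI := IwasawaAlgebra.isDiscreteValuationRing_quotient_X_pow_add_C p hm
        haveI := IwasawaAlgebra.EisensteinCoeff.isLocalRing_succ p hm
        letI := IwasawaAlgebra.EisensteinCoeff.algebraOfSpecSucc p m
        haveI := W.isScalarTower_algebraOfSpecSucc (K := K) (p := p) (m := m)
        letI := W.residueModuleSucc (K := K) (p := p) hm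
        ∀ (S : Finset (IsDedekindDomain.HeightOneSpectrum (NumberField.RingOfIntegers K)))
          (hpS : ∀ v, ((p : ℕ) : NumberField.RingOfIntegers K) ∈ v.asIdeal → v ∈ S)
          (hbad : ∀ v, v ∉ S → ((p : ℕ) : NumberField.RingOfIntegers K) ∉ v.asIdeal →
            (W.baseChange K).HasGoodReductionAt v)
          (_hSN : ∀ v ∈ S, ((p : ℕ) : NumberField.RingOfIntegers K) ∈ v.asIdeal ∨
            ((N : ℕ) : NumberField.RingOfIntegers K) ∈ v.asIdeal)
          (_hSσ : ∀ (σ : K ≃ₐ[ℚ] K) (v : IsDedekindDomain.HeightOneSpectrum (NumberField.RingOfIntegers K)),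
            σ • v ∈ S → v ∈ S)
          (L : Set (IsDedekindDomain.HeightOneSpectrum (NumberField.RingOfIntegers K)))
          (hL : L ⊆ (W.eisensteinTower (κ.unitTwist (-1)) hm).degreeTwoPrimes p)
          (hLS : ∀ v ∈ L, v ∉ S) (jbar' : AlgebraicClosure K →+* ℂ) (cd : ConjugationDatum K)
          (Dd : ∀ k, DualityDatum p cd ((W.eisensteinTower (κ.unitTwist (-1)) hm).ρ k)
            (IwasawaAlgebra.EisensteinCoeff p m (k + 1)))
          (fs : ∀ (k : ℕ) (n : Finset (IsDedekindDomain.HeightOneSpectrum (NumberField.RingOfIntegers K)))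
            (v : IsDedekindDomain.HeightOneSpectrum (NumberField.RingOfIntegers K)),
            galoisCohomology ((W.eisensteinLevelQuot (κ.unitTwist (-1)) hm k n).toLocal (Sum.inr v)) 1 →+
              SingularQuotient (GaloisRep.toLocal v (W.eisensteinLevelQuot (κ.unitTwist (-1)) hm k n)) ⊗[ℤ]
                Gell v)
          (t : ∀ k, ((W.baseChange K).torsionGaloisModule ((p : ℤ) ^ (k + 1))).toContRepresentation →ⁱL
            ((W.baseChange K).torsionGaloisModule ((p : ℤ) ^ k)).toContRepresentation)
          (ht : ∀ k (P : geomTorsion (W.baseChange K) ((p : ℤ) ^ (k + 1))),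
            t k P = (W.baseChange K).geomTorsionReduce p k P)
          (I : ZpExtension.EisensteinH1Data (κ.unitTwist (-1))
            (fun k ↦ (W.baseChange K).torsionGaloisModule ((p : ℤ) ^ k)) t hm)
          (hy : (W.eisensteinDVRSetting (κ.unitTwist (-1)) hm S hpS hbad L hL hLS jbar' cd Dd fs).SatisfiesH),
          (W.eisensteinDVRSetting (κ.unitTwist (-1)) hm S hpS hbad L hL hLS jbar' cd Dd fs).Conclusion hy
              (fun k ↦ I.proj (k + 1) (D.toEisensteinH1Linear hm t ht I hyp.topGenerator hyp.noPTorsion z)) →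
            Nonempty (HeegnerMuPartStabilized.SpecWitness (IwasawaAlgebra p) D.S X.X
              (CastellaGrossiLeeSkinner2022.stabilizedHeegnerModule D C)
              (PowerSeries.X ^ m + PowerSeries.C (p : ℤ_[p]) : IwasawaAlgebra p) (p ^ c))) :
    BeyondCarrierDepthX10b :=
  stub_beyondCarrier_of_upperLink_of_namedFacts h331 hChaL hKo
    (upperLinkX10b_anyClassNumber_of_howard_kolyvaginSystem_of_printFacts_of_controlGlue hCGLS h57 h59gp h422 h513 h331
      h161 h411 hB)

end Summit.BirchSwinnertonDyer.BirchSwinnertonDyer.Cruxes.BeyondCarrierDepthX10b.HowardFrames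

end
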